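import Summits.ResolutionOfSingularities.ResolutionOfSingularities.Theorems.MarkedTransferCampaignW46MohWindowSurfaceLocal
import Mathlib.Algebra.CharP.Lemmas
import HarnessLib

/-!
# [OURS · L1 W4.6 rung (iii-2), piece (T)] Surface Moh window for the typed Th. 16.6 procedure — CORE local-algebra inequality
# (cell res-hironaka, LADDER-RESOLUTION rung L, D-0089; unit res-L1-s46-pv-12 carried by res-D-pv-050; host MarkedTransfer,
# `--supports stmt-ResolutionOfSingularities-16155 --as helper`; statement file `…CampaignW46MohWindowSurface.lean` §5, res-L1-type-o1)

HONEST FRAMING. Nothing here is a statement of H. Hironaka's manuscript [Hironaka2017] and nothing here asserts that any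
statement of it holds. PURE COMMUTATIVE ALGEBRA over a regular local ring: the kernel of the one-blow-up step of rung (iii-2)
«purely inseparable SURFACE window `z^p + f(x,y)`, `p < ord f < 2p`, isolated singular locus, TAME tangent data». AI-written;
AI review is weaker than expert review. No `sorry`; axioms standard.

THE SITUATION (local ring `L = 𝒪_{Z′,ξ′}` of a singular point `ξ′` of the blow-up of a tame window point `ξ`, chart `t = x`):
downstairs `J_ξ = (z^p + f)`, `f = Σ_j a_j x^{d−j} y^j`, `p < d < 2p`; upstairs the transform is `(z₁^p + x^m · f̃)`, `m = d − p`,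
`z₁ = z/x`, `f̃ = Σ_j a_j y₁^j`, and `(x, ρ, z₁)` is a regular system of parameters with `f̃ ≡ ρ^μ · unit (mod x)`, `μ` the
multiplicity of the root of the residue binary form under `ξ′` — `μ < p` by TAMENESS (the companion chart file supplies these data
from the tree's `IsBlowup.exists_reesChart_stalk` / `chartQuotEquiv` / `isRsopPart_chartFamily_reesChart`).
`core`: if the same ideal is also `(z′^p + f″)` with `z′ ∈ 𝔪`, `f″ ∈ 𝔪^{d″}`, `d″ > p`, then `d″ ≤ m + μ` (`< d`). Proof by orders in
the regular quotients `L/(x,ρ)`, `L/(x,z₁)` (⇒ writing `z′ = αx + βρ + λz₁`: `λ` unit, `β ∈ 𝔪`), Frobenius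
`λ^p z₁^p = z′^p − α^p x^p − β^p ρ^p`, then `L/(z′)` and `L/(z′,x)`; the «re-entry» child `α ∉ 𝔪` (tangent plane turning to
`z₁ + αx = 0`) is covered. Tools: Zariski–Samuel VIII §1 Thm 1 / Matsumura 14.2, 17.10 as in the tree (`RegularLocalOrder`,
`RsopMonomialIdeals`, `RegularSystemOfParameters`). [ZariskiSamuel1960] [Matsumura1987]; the excluded heavy-root case is
Hauser–Wagner territory [HauserWagner2014] (res-D-pv-008's piece (H)).
-/

noncomputable section

set_option linter.dupNamespace false -- mandated namespace of this single-conjunct summit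

namespace Summit.ResolutionOfSingularities.ResolutionOfSingularities.Theorems.CampaignW46.MohWindowSurface

open IsLocalRing
open Literature.AlgebraicGeometry.Resolution

variable {L : Type*} [CommRing L] [IsRegularLocalRing L]

/-! ## 3. The core inequality -/

/-- **[OURS · L1 W4.6 rung (iii-2)] CORE INEQUALITY of the surface Moh window.** Let `L` be a regular local ring of
embedding dimension `3` and characteristic `p`, with regular system of parameters `(x, ρ, z₁)`; let `f ≡ ρ^μ · G (mod x)`
with `G` a unit and `μ < p`, and `1 ≤ m < p`. If the principal ideal `(z₁^p + x^m · f)` equals `(z′^p + f″)` for some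
`z′ ∈ 𝔪` and `f″ ∈ 𝔪^{d″}` with `d″ > p` (another «window presentation» at the same point), then `d″ ≤ m + μ`.
In the rung: `m = d − p`, so the residual order of EVERY window presentation at a singular point of the blow-up over a
TAME window point (`μ < p`) is `< d`. NOT a statement of the manuscript. [folklore] -/
theorem core (p : ℕ) [Fact p.Prime] [CharP L p] (h3 : (maximalIdeal L).spanFinrank = 3)
    {x ρ z₁ : L} (hgen : Ideal.span {x, ρ, z₁} = maximalIdeal L)
    {m μ : ℕ} (hm1 : 1 ≤ m) (hmp : m < p) (hμ : μ < p)
    {f G : L} (hG : IsUnit G) (hf : f - ρ ^ μ * G ∈ Ideal.span {x})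
    {z' f'' : L} {d'' : ℕ} (hz' : z' ∈ maximalIdeal L) (hf'' : f'' ∈ maximalIdeal L ^ d'')
    (hpd : p < d'') (heq : Ideal.span {z₁ ^ p + x ^ m * f} = Ideal.span {z' ^ p + f''}) :
    d'' ≤ m + μ := by
  classical
  haveI := isDomain_of_isRegularLocalRing (R := L)
  have hp1 : 1 ≤ p := (Fact.out : p.Prime).one_lt.le
  set g : L := z₁ ^ p + x ^ m * f with hg
  -- (1) the two generators differ by a unit
  obtain ⟨u, hu⟩ := Ideal.span_singleton_eq_span_singleton.mp heq
  -- membership facts downstairs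
  have hx𝔪 : x ∈ maximalIdeal L := hgen ▸ Ideal.subset_span (by simp)
  have hρ𝔪 : ρ ∈ maximalIdeal L := hgen ▸ Ideal.subset_span (by simp)
  have hz𝔪 : z₁ ∈ maximalIdeal L := hgen ▸ Ideal.subset_span (by simp)
  -- (2) expand `z'` in the parameters
  have hz'mem : z' ∈ Ideal.span ({x, ρ, z₁} : Set L) := hgen ▸ hz'
  obtain ⟨α, r, hr, hz'eq⟩ := Ideal.mem_span_insert.mp hz'mem
  obtain ⟨β, lam, rfl⟩ := Ideal.mem_span_pair.mp hr
  -- so `z' = α * x + (β * ρ + lam * z₁)`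
  -- (3) `lam` is a unit: read in `L/(x, ρ)`
  have hlam : IsUnit lam := by
    by_contra hlam
    have hlam𝔪 : lam ∈ maximalIdeal L := (mem_maximalIdeal _).mpr (mem_nonunits_iff.mpr hlam)
    obtain ⟨hreg, hz2⟩ := quotient_pair h3 hgen
    haveI := hreg
    have hle : Ideal.span {x, ρ} ≤ maximalIdeal L := by
      rw [Ideal.span_le]; intro a ha; rcases ha with rfl | rfl <;> simpa
    haveI := nontrivial_quotient_of_le hle
    set π := Ideal.Quotient.mk (Ideal.span ({x, ρ} : Set L)) with hπ
    have hπx : π x = 0 := Ideal.Quotient.eq_zero_iff_mem.mpr (Ideal.subset_span (by simp))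
    have hπρ : π ρ = 0 := Ideal.Quotient.eq_zero_iff_mem.mpr (Ideal.subset_span (by simp))
    have hπg : π g = π z₁ ^ p := by
      rw [hg, map_add, map_pow, map_mul, map_pow, hπx, zero_pow (by omega), zero_mul, add_zero]
    have hπz' : π z' = π lam * π z₁ := by
      rw [hz'eq, map_add, map_mul, map_add, map_mul, map_mul, hπx, hπρ, mul_zero, mul_zero, zero_add,
        zero_add]
    -- `π z' ∈ 𝔪̄²`, hence `π (z'^p + f'') ∈ 𝔪̄^{p+1}`
    have h1 : π z' ∈ maximalIdeal _ ^ 2 := by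
      rw [hπz', pow_two]
      exact Ideal.mul_mem_mul (mk_mem_maximalIdeal _ hlam𝔪) (mk_mem_maximalIdeal _ hz𝔪)
    have h2 : π (z' ^ p + f'') ∈ maximalIdeal _ ^ (p + 1) := by
      rw [map_add, map_pow]
      refine Ideal.add_mem _ ?_ ?_
      · have := Ideal.pow_mem_pow h1 p
        rw [← pow_mul] at this
        exact Ideal.pow_le_pow_right (by omega) this
      · exact Ideal.pow_le_pow_right (by omega) (mk_mem_maximalIdeal_pow _ hf'')
    rw [← hu, map_mul, hπg, mul_comm] at h2
    exact unit_mul_pow_not_mem_pow_succ hz2 ((Units.isUnit u).map π) p h2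
  -- (4) `β ∈ 𝔪`: read in `L/(x, z₁)`
  have hβ : β ∈ maximalIdeal L := by
    by_contra hβ
    have hβu : IsUnit β := not_not.mp fun h => hβ ((mem_maximalIdeal _).mpr (mem_nonunits_iff.mpr h))
    have hgen' : Ideal.span {x, z₁, ρ} = maximalIdeal L := by rw [← triple_swap]; exact hgen
    obtain ⟨hreg, hρ2⟩ := quotient_pair h3 hgen'
    haveI := hreg
    have hle : Ideal.span {x, z₁} ≤ maximalIdeal L := by
      rw [Ideal.span_le]; intro a ha; rcases ha with rfl | rfl <;> simpa
    haveI := nontrivial_quotient_of_le hle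
    set π := Ideal.Quotient.mk (Ideal.span ({x, z₁} : Set L)) with hπ
    have hπx : π x = 0 := Ideal.Quotient.eq_zero_iff_mem.mpr (Ideal.subset_span (by simp))
    have hπz : π z₁ = 0 := Ideal.Quotient.eq_zero_iff_mem.mpr (Ideal.subset_span (by simp))
    have hπg : π g = 0 := by
      rw [hg, map_add, map_pow, map_mul, map_pow, hπx, hπz, zero_pow (by omega), zero_pow (by omega),
        zero_mul, add_zero]
    have hπz' : π z' = π β * π ρ := by
      rw [hz'eq, map_add, map_mul, map_add, map_mul, map_mul, hπx, hπz, mul_zero, mul_zero, zero_add,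
        add_zero]
    -- `π z'^p = - π f'' ∈ 𝔪̄^{d''} ⊆ 𝔪̄^{p+1}`
    have h1 : π z' ^ p ∈ maximalIdeal _ ^ (p + 1) := by
      have h0 : π (z' ^ p + f'') = 0 := by rw [← hu, map_mul, hπg, zero_mul]
      rw [map_add, map_pow, add_eq_zero_iff_eq_neg] at h0
      rw [h0]
      exact Submodule.neg_mem _ (Ideal.pow_le_pow_right (by omega) (mk_mem_maximalIdeal_pow _ hf''))
    rw [hπz', mul_pow] at h1
    exact unit_mul_pow_not_mem_pow_succ hρ2 ((hβu.map π).pow p) p h1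
  -- (5) the new parameter system `(z', x, ρ)` and Frobenius
  obtain ⟨lam', hlam'⟩ := hlam.exists_left_inv
  have hz₁ : z₁ = lam' * (z' - α * x - β * ρ) := by
    have : z' - α * x - β * ρ = lam * z₁ := by rw [hz'eq]; ring
    rw [this, ← mul_assoc, hlam', one_mul]
  have hgen' : Ideal.span {z', x, ρ} = maximalIdeal L := by
    rw [← hgen]
    have hx1 : x ∈ Ideal.span ({z', x, ρ} : Set L) := Ideal.subset_span (by simp)
    have hρ1 : ρ ∈ Ideal.span ({z', x, ρ} : Set L) := Ideal.subset_span (by simp)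
    have hz'1 : z' ∈ Ideal.span ({z', x, ρ} : Set L) := Ideal.subset_span (by simp)
    have hx2 : x ∈ Ideal.span ({x, ρ, z₁} : Set L) := Ideal.subset_span (by simp)
    have hρ2 : ρ ∈ Ideal.span ({x, ρ, z₁} : Set L) := Ideal.subset_span (by simp)
    apply le_antisymm
    · rw [Ideal.span_le]
      rintro c (rfl | rfl | rfl)
      · exact hz'mem
      · exact hx2
      · exact hρ2
    · rw [Ideal.span_le]
      rintro c (rfl | rfl | rfl)
      · exact hx1
      · exact hρ1
      · rw [SetLike.mem_coe, hz₁]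
        exact Ideal.mul_mem_left _ _ (Ideal.sub_mem _ (Ideal.sub_mem _ hz'1 (Ideal.mul_mem_left _ _ hx1))
          (Ideal.mul_mem_left _ _ hρ1))
  -- Frobenius: `lam^p z₁^p = z'^p - α^p x^p - β^p ρ^p`
  have hfrob : lam ^ p * z₁ ^ p = z' ^ p - α ^ p * x ^ p - β ^ p * ρ ^ p := by
    have : lam * z₁ = z' - α * x - β * ρ := by rw [hz'eq]; ring
    rw [← mul_pow, this, sub_pow_char, sub_pow_char, mul_pow, mul_pow]
  -- the key identity: `lam^p x^m f - α^p x^p = g (lam^p - u) + f'' + β^p ρ^p`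
  have hkey : lam ^ p * (x ^ m * f) - α ^ p * x ^ p = g * (lam ^ p - u) + f'' + β ^ p * ρ ^ p := by
    have hg' : z' ^ p = g * u - f'' := by rw [hu]; ring
    have : lam ^ p * g = lam ^ p * z₁ ^ p + lam ^ p * (x ^ m * f) := by rw [hg]; ring
    rw [hfrob, hg'] at this
    linear_combination (-1 : L) * this
  -- suppose, for contradiction, `d'' ≥ m + μ + 1`
  by_contra hlt
  rw [not_le] at hlt
  set n := m + μ + 1 with hn
  have hnd : n ≤ d'' := by omega
  have hn2p : n ≤ 2 * p := by omega
  -- the right-hand side of `hkey` lies in `(z') + 𝔪^n`... read in `S = L/(z')`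
  obtain ⟨hregS, hxS, hρS⟩ := quotient_single h3 hgen'
  haveI := hregS
  have hleS : Ideal.span {z'} ≤ maximalIdeal L := Ideal.span_le.mpr (Set.singleton_subset_iff.mpr hz')
  haveI := nontrivial_quotient_of_le hleS
  set σ := Ideal.Quotient.mk (Ideal.span ({z'} : Set L)) with hσ
  have hσz' : σ z' = 0 := Ideal.Quotient.eq_zero_iff_mem.mpr (Ideal.subset_span (by simp))
  have hσg : σ g ∈ maximalIdeal _ ^ d'' := by
    -- `g = (z'^p + f'') u⁻¹`
    have : g = (z' ^ p + f'') * ↑u⁻¹ := by rw [← hu, mul_assoc, Units.mul_inv, mul_one]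
    rw [this, map_mul, map_add, map_pow, hσz', zero_pow (by omega), zero_add]
    exact Ideal.mul_mem_right _ _ (mk_mem_maximalIdeal_pow _ hf'')
  have hβρp : β ^ p * ρ ^ p ∈ maximalIdeal L ^ (2 * p) := by
    have hβρ : β * ρ ∈ maximalIdeal L ^ 2 := by rw [pow_two]; exact Ideal.mul_mem_mul hβ hρ𝔪
    have := Ideal.pow_mem_pow hβρ p
    rwa [← pow_mul, mul_pow] at this
  have hrhs : σ (g * (lam ^ p - u) + f'' + β ^ p * ρ ^ p) ∈ maximalIdeal _ ^ n := by
    have h1 : σ (g * (lam ^ p - u)) ∈ maximalIdeal _ ^ n := by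
      rw [map_mul]; exact Ideal.mul_mem_right _ _ (Ideal.pow_le_pow_right hnd hσg)
    have h2 : σ f'' ∈ maximalIdeal _ ^ n := Ideal.pow_le_pow_right hnd (mk_mem_maximalIdeal_pow _ hf'')
    have h3' : σ (β ^ p * ρ ^ p) ∈ maximalIdeal _ ^ n :=
      Ideal.pow_le_pow_right hn2p (mk_mem_maximalIdeal_pow _ hβρp)
    have := Ideal.add_mem _ (Ideal.add_mem _ h1 h2) h3'
    rwa [← map_add, ← map_add] at this
  -- hence `σ x ^ m * σ (lam^p f - α^p x^{p-m}) ∈ 𝔪̄^n`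
  set H : L := lam ^ p * f - α ^ p * x ^ (p - m) with hH
  have hfac : lam ^ p * (x ^ m * f) - α ^ p * x ^ p = x ^ m * H := by
    have : x ^ p = x ^ m * x ^ (p - m) := by rw [← pow_add, Nat.add_sub_cancel' hmp.le]
    rw [hH, this]; ring
  have hprod : σ x ^ m * σ H ∈ maximalIdeal _ ^ n := by
    have := hrhs
    rw [← hkey, hfac, map_mul, map_pow] at this
    exact this
  -- the order of `x̄` is exactly one, so `σ H ∈ 𝔪̄^{μ+1}`
  have hHS : σ H ∈ maximalIdeal _ ^ (μ + 1) := by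
    by_contra hHS
    have h1 : σ x ^ m ∉ maximalIdeal _ ^ (m * 1 + 1) :=
      pow_not_mem_pow_of_not_mem_pow (p := 1) (by simpa using hxS) m
    rw [mul_one] at h1
    have := mul_not_mem_pow_of_not_mem_pow h1 hHS
    rw [show m + μ + 1 = n from rfl] at this
    exact this hprod
  -- pull back to `L`: `H ∈ (z') + 𝔪^{μ+1}`
  have hHL : H ∈ Ideal.span {z'} ⊔ maximalIdeal L ^ (μ + 1) := mem_sup_pow_of_mk_mem _ hHS
  -- (5b) read `H` in `T = L/(z', x)`: there `H ↦ lam^p ρ^μ G`, a unit times `ρ̄^μ`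
  obtain ⟨hregT, hρT⟩ := quotient_pair h3 hgen'
  haveI := hregT
  have hleT : Ideal.span {z', x} ≤ maximalIdeal L := by
    rw [Ideal.span_le]; intro a ha; rcases ha with rfl | rfl <;> simpa
  haveI := nontrivial_quotient_of_le hleT
  set τ := Ideal.Quotient.mk (Ideal.span ({z', x} : Set L)) with hτ
  have hτz' : τ z' = 0 := Ideal.Quotient.eq_zero_iff_mem.mpr (Ideal.subset_span (by simp))
  have hτx : τ x = 0 := Ideal.Quotient.eq_zero_iff_mem.mpr (Ideal.subset_span (by simp))
  have hτf : τ f = τ ρ ^ μ * τ G := by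
    obtain ⟨c, hc⟩ := Ideal.mem_span_singleton'.mp hf
    have : f = ρ ^ μ * G + c * x := by rw [hc]; ring
    rw [this, map_add, map_mul, map_mul, map_pow, hτx, mul_zero, add_zero]
  have hpm : p - m ≠ 0 := by omega
  have hτH : τ H = τ (lam ^ p * G) * τ ρ ^ μ := by
    rw [hH]
    simp only [map_sub, map_mul, map_pow, hτx, zero_pow hpm, mul_zero, sub_zero, hτf]
    ring
  have hτHmem : τ H ∈ maximalIdeal _ ^ (μ + 1) := by
    obtain ⟨s, hs, q, hq, hsq⟩ := Submodule.mem_sup.mp hHL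
    rw [← hsq, map_add]
    refine Ideal.add_mem _ ?_ (mk_mem_maximalIdeal_pow _ hq)
    obtain ⟨c, rfl⟩ := Ideal.mem_span_singleton'.mp hs
    rw [map_mul, hτz', mul_zero]
    exact Ideal.zero_mem _
  rw [hτH] at hτHmem
  have hunit : IsUnit (τ (lam ^ p * G)) := ((hlam.pow p).mul hG).map τ
  exact unit_mul_pow_not_mem_pow_succ hρT hunit μ hτHmem

end Summit.ResolutionOfSingularities.ResolutionOfSingularities.Theorems.CampaignW46.MohWindowSurface

end
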